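import Summits.CriticalPhenomena.CardyFormulaZ2.Theorems.CardyBoundaryCoulombGasBoundaryDefectGaussianRStubRealisabilityPart18
import Summits.CriticalPhenomena.CardyFormulaZ2.Theorems.CardyBoundaryCoulombGasBoundaryDefectGaussianRS17DictionaryOfPart2

/-!
# Stub `stub_eventIdentity` of line `excursion-kernel-covariance` (crux `RectilinearCardy`,
# stmt-CriticalPhenomena-5660) — Part 1: strands of the completed configuration WITHOUT a height
# configuration (layer S of the lead's design `Lines/excursion-kernel-covariance-eventIdentity-design.md`)

The event identity `Rainbow ι V ω ↔ {X′ ↔ W₋₁} ∖ {W₋₃ ↔ W₋₁}` reads the Baxter–Kelland–Wu strands of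
the completed configuration `cfgOf ω` of a general collar leg model `M` purely combinatorially: a
STRAND is the stretch of the orbit of the turning rule `σ = nextCorner (M.cfgOf ω)` from a corner whose
predecessor is a cut (or untracked) — a START — to the first CUT corner met — a FINISH. The engine
line's rainbow forcing (`joined_of_not_isCut`, …StubRealisabilityPart18) follows strands only
together with a height configuration all of whose live turns are consistent; here no heights are
needed, because cuts (`CollarLegModel.IsCut`: frozen target, inconsistent turn of the PRESCRIBED
data) never sit at live targets and the turning rule at a frozen target does not see `ω`
(`nextCorner_cfgOf_eq_of_not_targetsLive`). Proved, for `ω ⊆ M.E`: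

* `ei_isTracked_iterate` — following non-cut turns keeps the orbit tracked (one step is the engine
  line's `dict_isTracked_nextCorner_of_not_isCut`, …S17DictionaryOfPart2);
* `ei_exists_firstCut` — from a tracked corner whose predecessor is a cut or untracked, the first
  cut along the orbit exists, at most `4·#vertexCells` turns away, all corners up to it tracked
  (pigeonhole + injectivity of `σ`), and it is not the start itself unless the start is a cut;
* `ei_joined_firstCut` — hence `M.Joined ω start finish`; `ei_eq_of_joined_of_isCut` — the finish of
  a strand is unique; `ei_eq_of_isCut_of_joined` — a cut is joined only to itself;
  `ei_start_eq_of_joined` — two starts joined to the same cut coincide (strands do not merge);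
* `ei_reachable_of_joined` — the vertices of two joined corners are joined by open edges of
  `cfgOf ω` (`reachable_iterate_nextCorner`).

All [folklore] over the definitions; no new objects.
-/

namespace Summit.CriticalPhenomena.CardyFormulaZ2.Cruxes.RectilinearCardy.ExcursionKernelCovariance

open Finset Literature.Probability.LatticeModels Literature.Probability.LatticeModels.CollarLegModel
open Summit.CriticalPhenomena.CardyFormulaZ2.Cruxes.BoundaryDefectGaussianR.RainbowMonomialsInExcursionKernels

section Strands

variable {M : CollarLegModel} {ω : Finset ((ℤ × ℤ) × Bool)}

/-- **Following non-cut turns keeps the orbit tracked**: from a tracked corner, if none of the first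
`n` turns is a cut then the first `n + 1` corners are tracked. [folklore] -/
theorem ei_isTracked_iterate (hω : ω ⊆ M.E) {c₀ : Site 2 × Fin 4} (h₀ : M.IsTracked c₀) (n : ℕ)
    (hn : ∀ m < n, ¬M.IsCut ((nextCorner (M.cfgOf ω))^[m] c₀)) :
    ∀ m ≤ n, M.IsTracked ((nextCorner (M.cfgOf ω))^[m] c₀) := by
  intro m
  induction m with
  | zero => intro; exact h₀
  | succ m _ =>
    intro hm
    rw [Function.iterate_succ_apply']
    exact dict_isTracked_nextCorner_of_not_isCut hω (hn m hm)

/-- **The first cut along the orbit of a start.** Let `e` be a tracked corner whose predecessor `p`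
(`σ p = e` in `cfgOf ω`) is a cut or is untracked. Then some corner `σ^n e`, `n ≤ 4·#vertexCells`, is
a cut, none before it is, and all corners up to it are tracked. (If no cut were met within
`4·#vertexCells + 1` turns, the tracked corners would repeat, the orbit would be periodic, and the
predecessor `p` would be a tracked non-cut corner of it.) [folklore] -/
theorem ei_exists_firstCut (hω : ω ⊆ M.E) {e p : Site 2 × Fin 4} (he : M.IsTracked e)
    (hpe : nextCorner (M.cfgOf ω) p = e) (hp : M.IsCut p ∨ ¬M.IsTracked p) :
    ∃ n, n ≤ 4 * M.vertexCells.card ∧ M.IsCut ((nextCorner (M.cfgOf ω))^[n] e) ∧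
      (∀ m < n, ¬M.IsCut ((nextCorner (M.cfgOf ω))^[m] e)) ∧
      (∀ m ≤ n, M.IsTracked ((nextCorner (M.cfgOf ω))^[m] e)) := by
  classical
  -- some cut within `4·#vertexCells` turns
  have hex : ∃ n, n ≤ 4 * M.vertexCells.card ∧ M.IsCut ((nextCorner (M.cfgOf ω))^[n] e) := by
    by_contra hno
    push Not at hno
    have htr : ∀ m ≤ 4 * M.vertexCells.card + 1, M.IsTracked ((nextCorner (M.cfgOf ω))^[m] e) :=
      ei_isTracked_iterate hω he _ fun m hm => hno m (Nat.lt_succ_iff.1 hm)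
    obtain ⟨i, j, hij, hj, hEq⟩ := exists_lt_iterate_eq htr (Nat.le_succ _)
    have hper := iterate_sub_eq_self hij hEq
    have hpred := iterate_pred_eq (Nat.le_sub_of_add_le' hij) hper hpe
    have hle : j - i - 1 ≤ 4 * M.vertexCells.card := by omega
    rcases hp with hp | hp
    · exact hno (j - i - 1) hle (by rw [hpred]; exact hp)
    · exact hp (by rw [← hpred]; exact htr _ (by omega))
  refine ⟨Nat.find hex, (Nat.find_spec hex).1, (Nat.find_spec hex).2, ?_, ?_⟩
  · intro m hm hc
    exact absurd (Nat.find_min' hex ⟨(le_of_lt hm).trans (Nat.find_spec hex).1, hc⟩) (not_le.2 hm)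
  · refine ei_isTracked_iterate hω he _ fun m hm hc => ?_
    exact absurd (Nat.find_min' hex ⟨(le_of_lt hm).trans (Nat.find_spec hex).1, hc⟩) (not_le.2 hm)

/-- **The strand of a start reaches its finish**: with `n` as in `ei_exists_firstCut`,
`M.Joined ω e (σ^n e)`. [folklore] -/
theorem ei_joined_firstCut {e : Site 2 × Fin 4} {n : ℕ} (hn : n ≤ 4 * M.vertexCells.card)
    (hbefore : ∀ m < n, ¬M.IsCut ((nextCorner (M.cfgOf ω))^[m] e)) :
    M.Joined ω e ((nextCorner (M.cfgOf ω))^[n] e) :=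
  ⟨n, hn, rfl, hbefore⟩

/-- **A cut is joined only to itself.** [folklore] -/
theorem ei_eq_of_isCut_of_joined {e c : Site 2 × Fin 4} (he : M.IsCut e) (hj : M.Joined ω e c) : c = e := by
  obtain ⟨n, -, hEq, hbefore⟩ := hj
  rcases Nat.eq_zero_or_pos n with h0 | hpos
  · subst h0; exact hEq.symm
  · exact absurd he (by simpa using hbefore 0 hpos)

/-- **The finish of a strand is unique**: a corner is joined (cut-free) to at most one cut. [folklore] -/
theorem ei_eq_of_joined_of_isCut {e f f' : Site 2 × Fin 4} (hf : M.Joined ω e f) (hcf : M.IsCut f)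
    (hf' : M.Joined ω e f') (hcf' : M.IsCut f') : f = f' := by
  obtain ⟨n, -, hEq, hb⟩ := hf
  obtain ⟨n', -, hEq', hb'⟩ := hf'
  rcases lt_trichotomy n n' with h | h | h
  · exact absurd hcf (by rw [← hEq]; exact hb' n h)
  · subst h; rw [← hEq, ← hEq']
  · exact absurd hcf' (by rw [← hEq']; exact hb n' h)

/-- **Strands do not merge**: two tracked starts (corners whose predecessors are cuts or untracked)
joined to the same cut coincide — otherwise the predecessor of one of them would be a tracked
non-cut corner of the other's strand (injectivity of the turning rule). [folklore] -/
theorem ei_start_eq_of_joined {M : CollarLegModel} {ω : Finset ((ℤ × ℤ) × Bool)} (hω : ω ⊆ M.E)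
    {e₁ e₂ p₁ p₂ f : Site 2 × Fin 4}
    (he₁ : M.IsTracked e₁) (he₂ : M.IsTracked e₂)
    (hp₁ : nextCorner (M.cfgOf ω) p₁ = e₁) (hq₁ : M.IsCut p₁ ∨ ¬M.IsTracked p₁)
    (hp₂ : nextCorner (M.cfgOf ω) p₂ = e₂) (hq₂ : M.IsCut p₂ ∨ ¬M.IsTracked p₂)
    (hj₁ : M.Joined ω e₁ f) (hj₂ : M.Joined ω e₂ f) : e₁ = e₂ := by
  -- symmetric core: if `σ^{n₁} e₁ = σ^{n₂} e₂` with `n₁ ≤ n₂` then `e₁ = σ^{n₂ - n₁} e₂`, and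
  -- `n₂ - n₁ = 0` because otherwise `p₁` lies on the strand of `e₂` strictly before its end
  have core : ∀ {a b pa : Site 2 × Fin 4} {na nb : ℕ}, M.IsTracked b →
      nextCorner (M.cfgOf ω) pa = a → (M.IsCut pa ∨ ¬M.IsTracked pa) →
      (∀ m < nb, ¬M.IsCut ((nextCorner (M.cfgOf ω))^[m] b)) →
      (nextCorner (M.cfgOf ω))^[na] a = (nextCorner (M.cfgOf ω))^[nb] b → na ≤ nb → a = b := by
    intro a b pa na nb hb hpa hqa hbb hEq hle
    have hk : (nextCorner (M.cfgOf ω))^[nb - na] b = a := by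
      apply (nextCorner_injective (β := M.cfgOf ω)).iterate na
      rw [← Function.iterate_add_apply, Nat.add_sub_cancel' hle]
      exact hEq.symm
    rcases Nat.eq_zero_or_pos (nb - na) with h0 | hpos
    · rw [h0] at hk; exact hk.symm
    · -- `pa = σ^{nb - na - 1} b`, a tracked non-cut corner: contradiction
      have hpred : (nextCorner (M.cfgOf ω))^[nb - na - 1] b = pa := by
        apply nextCorner_injective (β := M.cfgOf ω)
        rw [hpa, ← Function.iterate_succ_apply' (f := nextCorner (M.cfgOf ω)), Nat.succ_eq_add_one,
          Nat.sub_add_cancel hpos, hk]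
      have hlt : nb - na - 1 < nb := by omega
      have htr : M.IsTracked pa := by
        rw [← hpred]
        exact ei_isTracked_iterate hω hb nb hbb _ hlt.le
      rcases hqa with hqa | hqa
      · exact absurd hqa (by rw [← hpred]; exact hbb _ hlt)
      · exact absurd htr hqa
  obtain ⟨n₁, hn₁, hEq₁, hb₁⟩ := hj₁
  obtain ⟨n₂, hn₂, hEq₂, hb₂⟩ := hj₂
  have hEq : (nextCorner (M.cfgOf ω))^[n₁] e₁ = (nextCorner (M.cfgOf ω))^[n₂] e₂ := by rw [hEq₁, hEq₂]
  rcases le_total n₁ n₂ with h | h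
  · exact core he₂ hp₁ hq₁ hb₂ hEq h
  · exact (core he₁ hp₂ hq₂ hb₁ hEq.symm h).symm

/-- **Joined corners have joined vertices**: the vertices of two corners on one strand are joined by
open edges of the completed configuration. [folklore] -/
theorem ei_reachable_of_joined {c c' : Site 2 × Fin 4} (h : M.Joined ω c c') :
    (Literature.Probability.Percolation.openGraph (M.cfgOf ω)).Reachable c.1 c'.1 := by
  obtain ⟨n, -, hEq, -⟩ := h
  rw [← hEq]
  exact Literature.Probability.Percolation.reachable_iterate_nextCorner _ c n

end Strands

end Summit.CriticalPhenomena.CardyFormulaZ2.Cruxes.RectilinearCardy.ExcursionKernelCovariance
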